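import Mathlib
import HarnessLib
import Summits.HubbardSuperconductivity.HubbardSuperconductivity.Theorems.KLProgrammeKLRegimeEngineTowerLipschitz

/-!
# Route `KLProgramme` — crux K3 ENGINE (stmt-HubbardSuperconductivity-20437), stub (e) proof-input «(e)-D-ROWS», (M3)/(M4): THE ZONE BRACKET OF THE
# TWO-VOLUME LIPSCHITZ TOWER IN E1'S KIT UNITS — the boundary part of the difference, read at deep pins, is law-shaped with prefactor `Λ⁻¹`
# (seat hubbard-kl-k3c4-p1 g22; `--supports` 20437; DROWS-SCOPE-g22 §7.2 (ii)/(iii), §7.3 (S-zone))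

In the nested two-volume comparison the difference `Δ_k = D′_k − Glue_k D_k` of the fine action and the glued coarse action splits into a DEEP part (small,
read by the zone-free graded Lipschitz doors) and a BOUNDARY part `Δ^{bdry}` (label families touching the box seams; of the size of the one-volume laws,
NOT small).  At an output pin of depth `≥ r_k + ρ_k` the boundary bracket `incr(G′ + Δ^{bdry}) − incr(G′)` is read by the graded ZONE doors
(`Literature/…/GrassmannCumulantPolarisedGradedZoneDB`, `…GrassmannEffectiveActionGradedZoneLipschitzDB`, `…GrassmannGaussConvBinomialZone`), whose output is
`Λ × (unweighted pinned sums)` with `Λ = 1 + Λ_J·ρ_k` and whose inputs are the WEIGHTED profiles: the common majorant `μ` (both actions' one-volume laws,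
(b)-WT4) and the difference profile `ν ≤ 2μ` (triangle).  In E1's kit language this right side is EXACTLY the Lipschitz step of `…EngineTowerLipschitz`
(`towerFO D σ ν p + Σ_n eΦ^{n−1}ψ^p towerSLip D τ ν μ n p + Ct·tail`) with `db := Λ·zsrc` and no source.  This file reads it into T3-Lip₄'s `hsrc` row:

* `towerFO_le_two_mul`, `chernoff_le_two_mul` — `ν ≤ 2μ` pointwise doubles the first-order functional and the Chernoff datum;
* **`zoneSrc_le_chernoff`** (§2) — `Λ·zsrc ≤ 2F + e ψ^p (w^{p−1})⁻¹ (2G)·(2y−y²)/(1−y)²`, `y = ΦG` (E1's `towerLipStep_le_of_chernoff` with `Gν = 2G`, `Fν = 2F`);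
* **`zoneSrc_le_law`** (§3) — on the four-piece profile (`μ 1 ≤ ι₁λ`, `μ 2 ≤ ι₂λ`, `μ 3 ≤ ι₃λ²`, `μ m ≤ A'λ^{m−1}Q'^m`, `m ≥ 4`), under E1's guards
  `x₁ < 1`, `x₂`, `x₃`, `y = ΦτY < 1`, `θ̄ < 1` and scale separations `4Q' ≤ Q`, `2τψQ' ≤ Q` (E1's `hu₁`, `hu₂`), for `3 ≤ p ≤ D` and `0 < Λ`:
  **`zsrc ≤ s_z · (A λ^{p−1} Q^p)`**, `s_z = Λ⁻¹ · (2A'·x₁/(1−x₁) + 2eψτY·(2y − y²)/(1−y)²/Q)/A` — the bracket is NOT small in `λ` or in the guards; its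
  only smallness is `Λ⁻¹ ≍ 2^{J}/ρ_k` (DROWS-SCOPE-g22 §7.2 budget: `Σ_k Λ_k⁻¹·(…) ≲ K·2^{n}/L₁`, inside the rows' `d·4^{n}/L₁`).

NOT here: the model dictionary and the deep-region geometry (F-D3′), the near/far/transfer/frame sources (`…TwoVolumeLipSourceLaw` and sequels).  Pure real
analysis; nothing about the model is asserted; nothing asserts the (D) rows, stub (e), VL, K3 or superconductivity.
References: Benfatto–Giuliani–Mastropietro 2006 §2.8 (2.83), (2.86)–(2.90), §3 (3.2)–(3.8) [cite: BenfattoGiulianiMastropietro2006]; Gawȩdzki–Kupiainen 1985 §3.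
-/

noncomputable section

namespace Summit.HubbardSuperconductivity.HubbardSuperconductivity.Theorems.TwoVolumeDefect

set_option linter.dupNamespace false -- summit = problem name (single-conjunct summit), D-0017

open Real Finset
open Summit.HubbardSuperconductivity.HubbardSuperconductivity.Theorems.EngineV8

/-! ## §1 `ν ≤ 2μ` doubles the first order and the Chernoff datum -/

/-- The first-order functional is monotone and homogeneous in the profile: `ν ≤ 2μ` pointwise (`0 ≤ σ`) gives `towerFO D σ ν p ≤ 2·towerFO D σ μ p`. -/
theorem towerFO_le_two_mul {D : ℕ} {σ : ℝ} {μ ν : ℕ → ℝ} (hσ : 0 ≤ σ) (hνμ : ∀ m, ν m ≤ 2 * μ m) (p : ℕ) :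
    towerFO D σ ν p ≤ 2 * towerFO D σ μ p := by
  unfold towerFO
  rw [mul_sum]
  refine sum_le_sum fun m _ => ?_
  calc ((2 * m).choose (2 * p) : ℝ) * σ ^ (m - p) * ν m ≤ ((2 * m).choose (2 * p) : ℝ) * σ ^ (m - p) * (2 * μ m) :=
        mul_le_mul_of_nonneg_left (hνμ m) (by positivity)
    _ = 2 * (((2 * m).choose (2 * p) : ℝ) * σ ^ (m - p) * μ m) := by ring

/-- The Chernoff datum of `ν ≤ 2μ` is at most twice that of `μ` (`0 ≤ τ`, `0 ≤ w`). -/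
theorem chernoff_le_two_mul {D : ℕ} {τ w : ℝ} {μ ν : ℕ → ℝ} (hτ : 0 ≤ τ) (hw : 0 ≤ w) (hνμ : ∀ m, ν m ≤ 2 * μ m) {G : ℝ}
    (hG : ∑ δ ∈ Icc 1 D, τ ^ δ * μ δ * w ^ (δ - 1) ≤ G) :
    ∑ δ ∈ Icc 1 D, τ ^ δ * ν δ * w ^ (δ - 1) ≤ 2 * G := by
  calc ∑ δ ∈ Icc 1 D, τ ^ δ * ν δ * w ^ (δ - 1) ≤ ∑ δ ∈ Icc 1 D, τ ^ δ * (2 * μ δ) * w ^ (δ - 1) :=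
        sum_le_sum fun δ _ => by
          have h := hνμ δ
          have h1 : 0 ≤ τ ^ δ := pow_nonneg hτ _
          have h2 : 0 ≤ w ^ (δ - 1) := pow_nonneg hw _
          nlinarith [mul_nonneg h1 h2]
    _ = 2 * ∑ δ ∈ Icc 1 D, τ ^ δ * μ δ * w ^ (δ - 1) := by rw [mul_sum]; exact sum_congr rfl fun δ _ => by ring
    _ ≤ 2 * G := by linarith

/-! ## §2 The zone bracket in closed form from Chernoff data -/

/-- **The zone bracket in closed form from Chernoff data** (E1's T2-Lip with the difference profile `ν ≤ 2μ` and no source): for `0 ≤ μ, ν`,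
`ν ≤ 2μ`, a Chernoff parameter `w ≥ 1`, bounds `towerFO D σ μ p ≤ F`, `Σ_{δ∈[1,D]} τ^δ μ(δ) w^{δ−1} ≤ G`, `towerV D τ μ ≤ V̄`, `Φ·G < 1`, `Φ·V̄ < 1`,
and the zone doors' step hypothesis for `Λ·zsrc` (∀ N ≥ 2, under the guard `ΦV < 1`): `Λ·zsrc ≤ 2F + e·ψ^p·(w^{p−1})⁻¹·(2G)·(2y−y²)/(1−y)²`, `y = Φ·G`. -/
theorem zoneSrc_le_chernoff {D : ℕ} {ν μ : ℕ → ℝ} {zsrc Λ σ Φ ψ τ w F G Vb Ct : ℝ}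
    (hΦ : 0 ≤ Φ) (hψ : 0 ≤ ψ) (hτ : 0 ≤ τ) (hσ : 0 ≤ σ) (hν0 : ∀ m, 0 ≤ ν m) (hμ0 : ∀ m, 0 ≤ μ m) (hνμ : ∀ m, ν m ≤ 2 * μ m)
    (hw : 1 ≤ w) (hCt : 0 ≤ Ct) {p : ℕ} (hFp : towerFO D σ μ p ≤ F)
    (hG : ∑ δ ∈ Icc 1 D, τ ^ δ * μ δ * w ^ (δ - 1) ≤ G) (hVb : towerV D τ μ ≤ Vb) (hyG : Φ * G < 1) (hθ : Φ * Vb < 1)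
    (hstep : ∀ N : ℕ, 2 ≤ N → Φ * towerV D τ μ < 1 →
      Λ * zsrc ≤ towerFO D σ ν p + ∑ n ∈ Icc 2 N, exp 1 * Φ ^ (n - 1) * ψ ^ p * towerSLip D τ ν μ n p +
        Ct * (ψ ^ p * exp 1 * towerV D τ μ * (Φ * towerV D τ μ) ^ N / (1 - Φ * towerV D τ μ))) :
    Λ * zsrc ≤ 2 * F + exp 1 * ψ ^ p * (w ^ (p - 1))⁻¹ * (2 * G) * ((2 * (Φ * G) - (Φ * G) ^ 2) / (1 - Φ * G) ^ 2) := by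
  have hFν : towerFO D σ ν p ≤ 2 * F := (towerFO_le_two_mul (D := D) hσ hνμ p).trans (by linarith)
  have hGν : ∑ δ ∈ Icc 1 D, τ ^ δ * ν δ * w ^ (δ - 1) ≤ 2 * G := chernoff_le_two_mul hτ (zero_le_one.trans hw) hνμ hG
  have h := towerLipStep_le_of_chernoff (D := D) (ν := ν) (μ := μ) (db := Λ * zsrc) (src := (0 : ℝ)) hΦ hψ hτ hν0 hμ0 hw hCt (p := p)
    hFν hGν hG hVb hyG hθ (fun N hN hguard => by have := hstep N hN hguard; linarith)
  linarith

/-! ## §3 The `hsrc` law row of the zone bracket -/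

/-- **THE ZONE BRACKET IS LAW-SHAPED WITH PREFACTOR `Λ⁻¹`** (the `hsrc` row of `towerBornDiff_le_law₄` for the boundary part of the two-volume
difference).  On E1's four-piece majorant profile, with `ν ≤ 2μ`, the guards `x₁ = 4σλQ' < 1`, `x₂ : 2λτQ' ≤ 1`, `x₃ = eτλQ' < 1`, the geometric guard
`y = ΦτY < 1` (`Y = ι₁λ + ι₂/(2Q') + ι₃/(4Q'²) + A'Q'/4`), the field-norm guard `θ̄ < 1`, the scale separations `4Q' ≤ Q`, `2τψQ' ≤ Q`, and the zone doors'
step hypothesis for `Λ·zsrc` in E1's Lipschitz form (no source), for `3 ≤ p ≤ D`, `0 < Λ`, `0 < A`: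
**`zsrc ≤ s_z · (A λ^{p−1} Q^p)`**, `s_z = Λ⁻¹·(2A'·x₁/(1−x₁) + 2eψτY·(2y − y²)/(1−y)²/Q)/A`. -/
theorem zoneSrc_le_law {D : ℕ} {ν μ : ℕ → ℝ} {zsrc Λ σ Φ ψ τ lam Q' A' ι₁ ι₂ ι₃ A Q Ct : ℝ}
    (hΦ : 0 ≤ Φ) (hψ : 0 ≤ ψ) (hτ : 0 < τ) (hσ : 0 ≤ σ) (hlam : 0 < lam) (hQ' : 0 < Q') (hA' : 0 ≤ A') (hA : 0 < A) (hΛ : 0 < Λ)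
    (hν0 : ∀ m, 0 ≤ ν m) (hμ0 : ∀ m, 0 ≤ μ m) (hνμ : ∀ m, ν m ≤ 2 * μ m) (hCt : 0 ≤ Ct)
    (hι₁ : μ 1 ≤ ι₁ * lam) (hι₂ : μ 2 ≤ ι₂ * lam) (hι₃ : μ 3 ≤ ι₃ * lam ^ 2)
    (hprof : ∀ m, 4 ≤ m → m ≤ D → μ m ≤ A' * lam ^ (m - 1) * Q' ^ m)
    (hx₁ : 4 * σ * lam * Q' < 1) (hx₂ : 2 * lam * τ * Q' ≤ 1) (hx₃ : exp 1 * τ * lam * Q' < 1)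
    (hy : Φ * (τ * (ι₁ * lam + ι₂ / (2 * Q') + ι₃ / (4 * Q' ^ 2) + A' * Q' / 4)) < 1)
    (hθ : Φ * (exp 1 * τ * (ι₁ * lam) + (exp 1 * τ) ^ 2 * (ι₂ * lam) + (exp 1 * τ) ^ 3 * (ι₃ * lam ^ 2) +
      A' * (exp 1 * τ * Q') * ((exp 1 * τ * lam * Q') ^ 3 / (1 - exp 1 * τ * lam * Q'))) < 1)
    (hu₁ : 4 * Q' ≤ Q) (hu₂ : 2 * τ * ψ * Q' ≤ Q)
    {p : ℕ} (hp : 3 ≤ p) (hpD : p ≤ D)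
    (hstep : ∀ N : ℕ, 2 ≤ N → Φ * towerV D τ μ < 1 →
      Λ * zsrc ≤ towerFO D σ ν p + ∑ n ∈ Icc 2 N, exp 1 * Φ ^ (n - 1) * ψ ^ p * towerSLip D τ ν μ n p +
        Ct * (ψ ^ p * exp 1 * towerV D τ μ * (Φ * towerV D τ μ) ^ N / (1 - Φ * towerV D τ μ))) :
    zsrc ≤ (Λ⁻¹ * ((2 * A' * (4 * σ * lam * Q' / (1 - 4 * σ * lam * Q')) +
        2 * (exp 1 * (ψ * τ) * (ι₁ * lam + ι₂ / (2 * Q') + ι₃ / (4 * Q' ^ 2) + A' * Q' / 4)) *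
          ((2 * (Φ * (τ * (ι₁ * lam + ι₂ / (2 * Q') + ι₃ / (4 * Q' ^ 2) + A' * Q' / 4))) -
              (Φ * (τ * (ι₁ * lam + ι₂ / (2 * Q') + ι₃ / (4 * Q' ^ 2) + A' * Q' / 4))) ^ 2) /
            (1 - Φ * (τ * (ι₁ * lam + ι₂ / (2 * Q') + ι₃ / (4 * Q' ^ 2) + A' * Q' / 4))) ^ 2) / Q) / A)) *
      (A * lam ^ (p - 1) * Q ^ p) := by
  set Y : ℝ := ι₁ * lam + ι₂ / (2 * Q') + ι₃ / (4 * Q' ^ 2) + A' * Q' / 4 with hY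
  set y₁ : ℝ := Φ * (τ * Y) with hy₁def
  set z : ℝ := (2 * y₁ - y₁ ^ 2) / (1 - y₁) ^ 2 with hz
  have hQ : 0 < Q := lt_of_lt_of_le (by positivity) hu₁
  have hx0 : 0 ≤ 4 * σ * lam * Q' := by positivity
  have h1x : 0 < 1 - 4 * σ * lam * Q' := sub_pos.2 hx₁
  -- `Y ≥ 0`, `y₂ ≥ 0`, `z ≥ 0`
  have hι₁0 : 0 ≤ ι₁ * lam := (hμ0 1).trans hι₁
  have hι₂0 : 0 ≤ ι₂ := by
    by_contra h
    exact absurd ((hμ0 2).trans hι₂) (not_le.2 (mul_neg_of_neg_of_pos (not_le.1 h) hlam))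
  have hι₃0 : 0 ≤ ι₃ := by
    by_contra h
    exact absurd ((hμ0 3).trans hι₃) (not_le.2 (mul_neg_of_neg_of_pos (not_le.1 h) (by positivity)))
  have hY0 : 0 ≤ Y := by rw [hY]; positivity
  have hy₁0 : 0 ≤ y₁ := by rw [hy₁def]; positivity
  have hy₁1 : y₁ < 1 := hy
  have hz0 : 0 ≤ z := div_nonneg (by nlinarith) (sq_nonneg _)
  -- Chernoff data of `μ` at `w = (2τQ'λ)⁻¹`
  have hw : 1 ≤ (2 * τ * Q' * lam)⁻¹ := (one_le_inv₀ (by positivity)).2 (by linarith)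
  have hG := sum_fourPiece_le (D := D) hτ hlam hQ' hA' hμ0 hι₁ hι₂ hι₃ hprof
  have hVb := towerV_le_fourPiece (D := D) hτ.le hlam.le hQ'.le hA' hμ0 hι₁ hι₂ hι₃ hprof hx₃
  have hFO := towerFO_le_of_four_le (D := D) hσ hA' hlam.le hQ'.le hμ0 hprof hx₁ hp
  -- §2
  have hyG : Φ * (τ * Y) < 1 := hy
  have h2 := zoneSrc_le_chernoff (D := D) hΦ hψ hτ.le hσ hν0 hμ0 hνμ hw hCt (p := p) hFO hG hVb hyG hθ hstep
  -- rewrite `(w^{p−1})⁻¹ = (2τQ'λ)^{p−1}` and regroup the graded term into `λ^{p−1}·2eψτY(2τψQ')^{p−1}·z`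
  have hwpow : (((2 * τ * Q' * lam)⁻¹) ^ (p - 1))⁻¹ = (2 * τ * Q' * lam) ^ (p - 1) := by rw [inv_pow, inv_inv]
  rw [hwpow] at h2
  have hgr : exp 1 * ψ ^ p * (2 * τ * Q' * lam) ^ (p - 1) * (2 * (τ * Y)) * z =
      lam ^ (p - 1) * (2 * (exp 1 * (ψ * τ) * Y) * (2 * τ * ψ * Q') ^ (p - 1)) * z := by
    obtain ⟨q, rfl⟩ : ∃ q, p = q + 1 := ⟨p - 1, by omega⟩
    simp only [Nat.add_sub_cancel, pow_succ, mul_pow]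
    ring
  have h2' : Λ * zsrc ≤ 2 * (A' * lam ^ (p - 1) * (4 * Q') ^ p * (4 * σ * lam * Q' / (1 - 4 * σ * lam * Q'))) +
      lam ^ (p - 1) * (2 * (exp 1 * (ψ * τ) * Y) * (2 * τ * ψ * Q') ^ (p - 1)) * z := by
    rw [← hgr]; exact h2
  -- scale separations
  have h4 : (4 * Q') ^ p ≤ Q ^ p := pow_le_pow_left₀ (by positivity) hu₁ p
  have h2τ : (2 * τ * ψ * Q') ^ (p - 1) ≤ Q ^ p / Q := by
    have h := pow_le_pow_left₀ (by positivity) hu₂ (p - 1)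
    refine h.trans (le_of_eq ?_)
    obtain ⟨q, rfl⟩ : ∃ q, p = q + 1 := ⟨p - 1, by omega⟩
    rw [Nat.add_sub_cancel, pow_succ, mul_div_assoc, div_self hQ.ne', mul_one]
  have hlam0 : 0 ≤ lam ^ (p - 1) := pow_nonneg hlam.le _
  have hfrac0 : 0 ≤ 4 * σ * lam * Q' / (1 - 4 * σ * lam * Q') := div_nonneg hx0 h1x.le
  have h3 : Λ * zsrc ≤ (2 * A' * (4 * σ * lam * Q' / (1 - 4 * σ * lam * Q')) + 2 * (exp 1 * (ψ * τ) * Y) * z / Q) *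
      (lam ^ (p - 1) * Q ^ p) := by
    calc Λ * zsrc ≤ 2 * (A' * lam ^ (p - 1) * (4 * Q') ^ p * (4 * σ * lam * Q' / (1 - 4 * σ * lam * Q'))) +
          lam ^ (p - 1) * (2 * (exp 1 * (ψ * τ) * Y) * (2 * τ * ψ * Q') ^ (p - 1)) * z := h2'
      _ ≤ 2 * (A' * lam ^ (p - 1) * Q ^ p * (4 * σ * lam * Q' / (1 - 4 * σ * lam * Q'))) +
          lam ^ (p - 1) * (2 * (exp 1 * (ψ * τ) * Y) * (Q ^ p / Q)) * z := by
          gcongr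
      _ = (2 * A' * (4 * σ * lam * Q' / (1 - 4 * σ * lam * Q')) + 2 * (exp 1 * (ψ * τ) * Y) * z / Q) * (lam ^ (p - 1) * Q ^ p) := by
          field_simp
  -- divide by `Λ` and insert `A`
  have hfinal : zsrc ≤ Λ⁻¹ * ((2 * A' * (4 * σ * lam * Q' / (1 - 4 * σ * lam * Q')) + 2 * (exp 1 * (ψ * τ) * Y) * z / Q) / A) *
      (A * lam ^ (p - 1) * Q ^ p) := by
    have hdiv : zsrc ≤ Λ⁻¹ * ((2 * A' * (4 * σ * lam * Q' / (1 - 4 * σ * lam * Q')) + 2 * (exp 1 * (ψ * τ) * Y) * z / Q) *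
        (lam ^ (p - 1) * Q ^ p)) := by
      calc zsrc = Λ⁻¹ * (Λ * zsrc) := by field_simp
        _ ≤ _ := mul_le_mul_of_nonneg_left h3 (inv_nonneg.2 hΛ.le)
    refine hdiv.trans (le_of_eq ?_)
    field_simp
  exact hfinal

end Summit.HubbardSuperconductivity.HubbardSuperconductivity.Theorems.TwoVolumeDefect

end
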